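import Summits.AtomisticToContinuum.BoseEinsteinCondensation.Theorems.InsertionFieldDelocalisation.Negative.Toolkit
import Summits.AtomisticToContinuum.BoseEinsteinCondensation.Theorems.InsertionFieldDelocalisation.Negative.PerronExistence
import HarnessLib

/-!
# Negative lemmas for crux `InsertionFieldDelocalisation` (stmt-AtomisticToContinuum-9673), II:
load-bearing hypotheses

Supports (does not close) stmt-AtomisticToContinuum-9673, route `BECStronglyRayleigh`.

* `insertionFieldDelocalisation_false_without_groundState` : with the eigen-equation `Hψ = E_min ψ`
  dropped (sector, `ψ ≠ 0`, nonnegativity kept) the crux is FALSE — frozen pair `δ_{1_{{a,b}}}`,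
  `N = 2`: `r^∅ = 1_{{a,b}}`, `Q = L³`.
* `insertionFieldDelocalisation_false_without_halfFilling` : with `2N ≤ L³` dropped it is FALSE —
  `N = L³`, the all-up state spans the top sector, `H|↑…↑⟩ = 0 = E_min` (`xxz_apply_allUp`,
  `lowestEnergyInSector_allUp`); the two-hole field is `1_{Tᶜ}` on two sites, `Q = L³`.
  (By particle–hole symmetry the functional for `N > L³/2` is a different, hole-removal field of the
  conjugate state: the restriction is genuinely needed.)
* Not load-bearing (remarks, no Lean content): `2 ≤ N`, `2 ≤ L` (vacuous / `r ≡ 0` otherwise);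
  nonnegativity of `ψ` is only needed to avoid Perron uniqueness (both sides scale by `cos²θ`).
-/

noncomputable section

namespace Summit.AtomisticToContinuum.BoseEinsteinCondensation.Theorems.InsertionFieldDelocalisation.Negative

open scoped BigOperators ComplexOrder
open Literature.MathematicalPhysics.QuantumLattice Literature.Probability.LatticeModels Matrix Finset
open Summit.AtomisticToContinuum.BoseEinsteinCondensation.Theses.BECStronglyRayleigh

/-! ### (a) Load-bearing hypotheses

For each hypothesis `H` of the crux we record the crux with `H` deleted and, when that is false, a
kernel-checked witness ("any proof must use `H`"). -/

section LoadBearing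

/-- Two distinct sites of `(ℤ/Lℤ)³`, `L ≥ 2`. [folklore] -/
theorem exists_pair_torusSite (L : ℕ) [NeZero L] (hL : 2 ≤ L) : ∃ a b : TorusSite 3 L, a ≠ b := by
  have h : 1 < Fintype.card (TorusSite 3 L) := by
    rw [card_torusSite 3 L]
    calc 1 < 2 ^ 3 := by norm_num
      _ ≤ L ^ 3 := Nat.pow_le_pow_left hL 3
  obtain ⟨a, b, hab⟩ := Fintype.exists_pair_of_one_lt_card h
  exact ⟨a, b, hab⟩


/-! #### The eigen-equation -/

/-- The crux with the eigenvector hypothesis `Hψ = E_min(sector) ψ` deleted (keeping: sector, `ψ ≠ 0`,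
entrywise real nonnegative). -/
def WithoutGroundState : Prop :=
  ∃ M : ℝ, ∀ (L : ℕ) [NeZero L], 2 ≤ L → ∀ N : ℕ, 2 ≤ N → 2 * N ≤ L ^ 3 →
    ∀ ψ : TensorIndex (TorusSite 3 L) 2 → ℂ,
      ψ ∈ spinZSector 1 ((N : ℝ) - (L : ℝ) ^ 3 / 2) → ψ ≠ 0 →
      (∀ σ, 0 ≤ (ψ σ).re ∧ (ψ σ).im = 0) → K1Ineq M L N ψ

/-- The two-particle insertion field of the frozen-pair state `δ_{1_{{a,b}}}` (`N = 2`, `T = ∅`) is the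
indicator of `{a, b}`. [folklore] -/
theorem field_pairState {Λ : Type*} [Fintype Λ] [DecidableEq Λ] {a b : Λ} (hab : a ≠ b) :
    field (bvec (fun z => if z ∈ ({a, b} : Finset Λ) then (0 : Fin 2) else 1)) ∅ =
      fun x => if x = a ∨ x = b then 1 else 0 := by
  funext x
  simp only [field, Finset.notMem_empty, not_false_eq_true, true_and, bvec_ind_re, insert_empty_eq]
  have hpair : ∀ y, (({x, y} : Finset Λ) = {a, b}) ↔ (x = a ∧ y = b ∨ x = b ∧ y = a) := by
    intro y
    rw [← Finset.coe_inj, Finset.coe_pair, Finset.coe_pair, Set.pair_eq_pair_iff]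
  simp_rw [hpair]
  by_cases hxa : x = a
  · subst hxa
    rw [if_pos (Or.inl rfl)]
    rw [Finset.sum_eq_single b]
    · simp [hab]
    · intro y _ hyb
      simp [hyb, hab]
    · simp
  · by_cases hxb : x = b
    · subst hxb
      rw [if_pos (Or.inr rfl)]
      rw [Finset.sum_eq_single a]
      · simp [hab, Ne.symm hab]
      · intro y _ hya
        simp [hya, hxa]
      · simp
    · rw [if_neg (not_or.mpr ⟨hxa, hxb⟩)]
      refine Finset.sum_eq_zero fun y _ => ?_
      simp [hxa, hxb]

/-- **Any proof must use the eigen-equation**: with `Hψ = E_min ψ` deleted the crux is false.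
Witness: `N = 2`, `ψ = δ_{1_{{a,b}}}` (one frozen pair): `r^∅ = 1_{{a,b}}`, so
`L³ · ‖r‖²Φ_∅ = 2L³` against `M‖r‖² = 2M`, i.e. `L³ ≤ M` for every `L`. [folklore] -/
theorem insertionFieldDelocalisation_false_without_groundState : ¬ WithoutGroundState := by
  rintro ⟨M, hM⟩
  obtain ⟨L, hL2, hLM⟩ := exists_side_gt M
  haveI : NeZero L := ⟨by omega⟩
  obtain ⟨a, b, hab⟩ := exists_pair_torusSite L hL2
  have hNL : 2 * 2 ≤ L ^ 3 :=
    calc 2 * 2 ≤ 2 ^ 3 := by norm_num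
      _ ≤ L ^ 3 := Nat.pow_le_pow_left hL2 3
  have hsec : bvec (fun z => if z ∈ ({a, b} : Finset (TorusSite 3 L)) then (0 : Fin 2) else 1) ∈
      spinZSector 1 (((2 : ℕ) : ℝ) - (L : ℝ) ^ 3 / 2) := by
    refine bvec_ind_mem_spinZSector _ _ ?_
    rw [Finset.card_pair hab, card_torusSite 3 L]
    push_cast
    ring
  have key := hM L hL2 2 le_rfl hNL _ hsec (bvec_ne_zero _) (bvec_nonneg _)
  have hcard : (Finset.univ.filter fun x : TorusSite 3 L => x = a ∨ x = b).card = 2 := by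
    have hf : (Finset.univ.filter fun x : TorusSite 3 L => x = a ∨ x = b) = {a, b} := by
      ext x; simp
    rw [hf, Finset.card_pair hab]
  rw [K1Ineq, show 2 - 2 = 0 from rfl, Finset.powersetCard_zero, Finset.sum_singleton,
    Finset.sum_singleton, field_pairState hab, K1lhs_boolIndicator _ (by rw [hcard]; norm_num),
    K1rhs_boolIndicator, hcard] at key
  norm_num at key
  linarith

/-! #### Full filling: the all-up state, and the restriction `2N ≤ L³` -/

section FullFilling

variable {Λ : Type*} [Fintype Λ] [DecidableEq Λ]

/-- The spin-`½` raising operator kills the up state: `⟨k| S⁺ |0⟩ = 0`. [folklore] -/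
theorem spinRaise_apply_up (k : Fin 2) : spinRaise 1 k 0 = 0 := by
  rw [spinRaise_apply, if_neg]
  simp

/-- The XY edge term `S¹_xS¹_y + S²_xS²_y (+ 0·S³_xS³_y) = ½(S⁺_xS⁻_y + S⁻_xS⁺_y)` has no matrix
entry into the all-up configuration (`S⁺|↑⟩ = 0`). [folklore] -/
theorem xyEdge_apply_allUp {x y : Λ} (hxy : x ≠ y) (σ : TensorIndex Λ 2) :
    (spinBond 1 0 x y + spinBond 1 1 x y + (((0 : ℝ) : ℂ)) • spinBond 1 2 x y) σ (fun _ => 0) = 0 := by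
  rw [Complex.ofReal_zero, zero_smul, add_zero, Matrix.add_apply, spinBond_apply_of_ne 1 0 hxy,
    spinBond_apply_of_ne 1 1 hxy]
  split_ifs with h
  · rw [spinVec_zero, spinVec_one, spinX_mul_spinX_add_spinY_mul_spinY, spinRaise_apply_up,
      spinRaise_apply_up]
    ring
  · rw [add_zero]

/-- The XXZ Hamiltonian at `Δ = 0` (any graph, any `J`) has vanishing column at the all-up
configuration: `H |↑…↑⟩ = 0`. [folklore] -/
theorem xxz_apply_allUp (G : SimpleGraph Λ) [DecidableRel G.Adj] (J : ℝ) (σ : TensorIndex Λ 2) :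
    xxzHamiltonian 1 G J 0 σ (fun _ => 0) = 0 := by
  rw [xxzHamiltonian, Matrix.smul_apply, Matrix.sum_apply, Finset.sum_eq_zero, smul_zero]
  intro e he
  induction e using Sym2.ind with
  | h x y =>
    have hxy : x ≠ y := G.ne_of_adj (by simpa using he)
    simp only [Sym2.lift_mk]
    exact xyEdge_apply_allUp hxy σ

/-- `H ψ = 0` for every `ψ` supported on the all-up configuration. [folklore] -/
theorem xxz_mulVec_eq_zero_of_support (G : SimpleGraph Λ) [DecidableRel G.Adj] (J : ℝ)
    (ψ : TensorIndex Λ 2 → ℂ) (hψ : ∀ σ, σ ≠ (fun _ => 0) → ψ σ = 0) :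
    xxzHamiltonian 1 G J 0 *ᵥ ψ = 0 := by
  funext σ
  rw [mulVec, dotProduct, Pi.zero_apply, Finset.sum_eq_single (fun _ => (0 : Fin 2))]
  · rw [xxz_apply_allUp, zero_mul]
  · intro τ _ hτ
    rw [hψ τ hτ, mul_zero]
  · intro h
    exact absurd (Finset.mem_univ _) h

omit [DecidableEq Λ] in
/-- A configuration has weight `Σ_x σ_x = 0` iff it is the all-up configuration. [folklore] -/
theorem weight_eq_zero_iff (σ : TensorIndex Λ 2) : (∑ x, (σ x : ℕ)) = 0 ↔ σ = fun _ => 0 := by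
  rw [Finset.sum_eq_zero_iff]
  constructor
  · intro h
    funext x
    exact Fin.ext (h x (Finset.mem_univ x))
  · rintro rfl
    simp

/-- **Sector energy of the saturated sector.** In the one-dimensional top sector `S³_tot = |Λ|/2`
(all spins up) the sector energy of the `Δ = 0` XXZ Hamiltonian is `0`. [folklore] -/
theorem lowestEnergyInSector_allUp (G : SimpleGraph Λ) [DecidableRel G.Adj] (J : ℝ) (M₀ : ℝ)
    (hM₀ : M₀ = (Fintype.card Λ : ℝ) / 2) :
    lowestEnergyInSector 1 (xxzHamiltonian 1 G J 0) M₀ = 0 := by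
  have hK : ∀ ψ : TensorIndex Λ 2 → ℂ, ψ ∈ spinZSector (Λ := Λ) 1 M₀ ↔
      ∀ σ, σ ≠ (fun _ => 0) → ψ σ = 0 := by
    intro ψ
    have h := LiebMattis.mem_spinZSector_weight_iff (Λ := Λ) 1 0 ψ
    have hM : (((Fintype.card Λ * 1 : ℕ) : ℝ) / 2 - ((0 : ℕ) : ℝ)) = M₀ := by
      rw [hM₀]; push_cast; ring
    rw [hM] at h
    rw [h]
    refine forall_congr' fun σ => ?_
    constructor
    · intro h' hσ
      exact h' fun hsum => hσ ((weight_eq_zero_iff σ).mp hsum)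
    · intro h' hsum
      exact h' fun hσ => hsum ((weight_eq_zero_iff σ).mpr hσ)
  have hset : {E : ℝ | ∃ ψ ∈ spinZSector (Λ := Λ) 1 M₀, star ψ ⬝ᵥ ψ = 1 ∧
      E = (star ψ ⬝ᵥ xxzHamiltonian 1 G J 0 *ᵥ ψ).re} = {0} := by
    ext E
    simp only [Set.mem_setOf_eq, Set.mem_singleton_iff]
    constructor
    · rintro ⟨ψ, hψ, -, rfl⟩
      rw [xxz_mulVec_eq_zero_of_support G J ψ ((hK ψ).1 hψ), dotProduct_zero, Complex.zero_re]
    · rintro rfl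
      have hsupp : ∀ σ : TensorIndex Λ 2, σ ≠ (fun _ => 0) → bvec (fun _ => (0 : Fin 2)) σ = 0 :=
        fun σ hσ => by rw [bvec_apply, if_neg hσ]
      refine ⟨bvec (fun _ => 0), (hK _).2 hsupp, ?_, ?_⟩
      · simp [dotProduct, bvec_apply, Finset.sum_ite_eq']
      · rw [xxz_mulVec_eq_zero_of_support G J (bvec fun _ => 0) hsupp, dotProduct_zero,
          Complex.zero_re]
  rw [lowestEnergyInSector, Matrix.minEnergyOn, hset, csInf_singleton]

/-- The two-hole insertion field of the full state `δ_{1_Λ}` at a `(|Λ|-2)`-set `T` is the indicator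
of `Tᶜ`. [folklore] -/
theorem field_fullState (T : Finset Λ) (hT : T.card + 2 = Fintype.card Λ) :
    field (bvec (fun z => if z ∈ (Finset.univ : Finset Λ) then (0 : Fin 2) else 1)) T =
      fun x => if x ∉ T then 1 else 0 := by
  funext x
  simp only [field, bvec_ind_re]
  have hfull : ∀ y, x ∉ T ∧ y ∉ T ∧ x ≠ y → insert x (insert y T) = Finset.univ := by
    rintro y ⟨hx, hy, hxy⟩
    apply Finset.eq_univ_of_card
    rw [Finset.card_insert_of_notMem (by simp [hx, hxy]), Finset.card_insert_of_notMem hy, hT]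
  rw [Finset.sum_congr rfl fun y _ => show (if x ∉ T ∧ y ∉ T ∧ x ≠ y then
      (if insert x (insert y T) = Finset.univ then (1 : ℝ) else 0) else 0) =
      if x ∉ T ∧ y ∉ T ∧ x ≠ y then 1 else 0 by
    split_ifs with h1 h2
    · rfl
    · exact absurd (hfull y h1) h2
    · rfl]
  by_cases hx : x ∈ T
  · rw [if_neg (not_not.mpr hx)]
    exact Finset.sum_eq_zero fun y _ => if_neg fun h => h.1 hx
  · rw [if_pos hx, Finset.sum_boole]
    have hf : (Finset.univ.filter fun y => x ∉ T ∧ y ∉ T ∧ x ≠ y) = Tᶜ.erase x := by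
      ext y
      simp only [Finset.mem_filter, Finset.mem_univ, true_and, Finset.mem_erase, Finset.mem_compl]
      tauto
    rw [hf, Finset.card_erase_of_mem (Finset.mem_compl.mpr hx), Finset.card_compl]
    have h2 : Fintype.card Λ - T.card - 1 = 1 := by omega
    rw [h2]
    simp

/-- `#{x ∉ T} = 2` when `|T| + 2 = |Λ|`. [folklore] -/
theorem card_filter_notMem (T : Finset Λ) (hT : T.card + 2 = Fintype.card Λ) :
    (Finset.univ.filter fun x => x ∉ T).card = 2 := by
  have hf : (Finset.univ.filter fun x => x ∉ T) = Tᶜ := by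
    ext x; simp
  rw [hf, Finset.card_compl]
  omega

end FullFilling

/-- The crux with the filling restriction `2N ≤ L³` deleted. -/
def WithoutHalfFilling : Prop :=
  ∃ M : ℝ, ∀ (L : ℕ) [NeZero L], 2 ≤ L → ∀ N : ℕ, 2 ≤ N →
    ∀ ψ : TensorIndex (TorusSite 3 L) 2 → ℂ,
      ψ ∈ spinZSector 1 ((N : ℝ) - (L : ℝ) ^ 3 / 2) → ψ ≠ 0 →
      (xyTorus 3 L 1).mulVec ψ =
        ((lowestEnergyInSector 1 (xyTorus 3 L 1) ((N : ℝ) - (L : ℝ) ^ 3 / 2) : ℝ) : ℂ) • ψ →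
      (∀ σ, 0 ≤ (ψ σ).re ∧ (ψ σ).im = 0) → K1Ineq M L N ψ

/-- The K1 functional on the full state (`N = L³`, `ψ = |↑…↑⟩`): every `(L³-2)`-set `T` carries the
field `1_{Tᶜ}` on two sites, so the inequality reads `L³ · 2·C(L³,2) ≤ M · 2·C(L³,2)`. [folklore] -/
theorem K1Ineq_fullState_iff (M : ℝ) (L : ℕ) [NeZero L] (hL : 2 ≤ L) :
    K1Ineq M L (L ^ 3)
        (bvec (fun z => if z ∈ (Finset.univ : Finset (TorusSite 3 L)) then (0 : Fin 2) else 1)) ↔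
      (L : ℝ) ^ 3 ≤ M := by
  have hL3 : 2 ≤ L ^ 3 :=
    calc 2 ≤ 2 ^ 3 := by norm_num
      _ ≤ L ^ 3 := Nat.pow_le_pow_left hL 3
  have hTcard : ∀ T ∈ (Finset.univ : Finset (TorusSite 3 L)).powersetCard (L ^ 3 - 2),
      T.card + 2 = Fintype.card (TorusSite 3 L) := by
    intro T hT
    rw [(Finset.mem_powersetCard.mp hT).2, card_torusSite 3 L]
    omega
  have hF : ∀ T ∈ (Finset.univ : Finset (TorusSite 3 L)).powersetCard (L ^ 3 - 2),
      K1lhs (field (bvec (fun z => if z ∈ (Finset.univ : Finset (TorusSite 3 L)) then (0 : Fin 2)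
        else 1)) T) = 2 := by
    intro T hT
    rw [field_fullState T (hTcard T hT), K1lhs_boolIndicator]
    rw [card_filter_notMem T (hTcard T hT)]
    norm_num
  have hG : ∀ T ∈ (Finset.univ : Finset (TorusSite 3 L)).powersetCard (L ^ 3 - 2),
      K1rhs (field (bvec (fun z => if z ∈ (Finset.univ : Finset (TorusSite 3 L)) then (0 : Fin 2)
        else 1)) T) = 2 := by
    intro T hT
    rw [field_fullState T (hTcard T hT), K1rhs_boolIndicator, card_filter_notMem T (hTcard T hT)]
    norm_num
  rw [K1Ineq, Finset.sum_congr rfl hF, Finset.sum_congr rfl hG, Finset.sum_const,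
    Finset.card_powersetCard, Finset.card_univ, card_torusSite 3 L, nsmul_eq_mul]
  have hc : (0 : ℝ) < ((L ^ 3).choose (L ^ 3 - 2) : ℕ) * 2 := by
    have : 0 < (L ^ 3).choose (L ^ 3 - 2) := Nat.choose_pos (Nat.sub_le _ _)
    positivity
  constructor
  · intro h
    exact le_of_mul_le_mul_right h hc
  · intro h
    exact mul_le_mul_of_nonneg_right h hc.le

/-- **Any proof must use `2N ≤ L³`**: without the filling restriction the crux is false.
Witness: `N = L³`; the saturated sector is spanned by `|↑…↑⟩`, an eigenvector with
`H|↑…↑⟩ = 0 = E_min`; its two-hole field at each `T` lives on the two sites of `Tᶜ`, so `L³Φ_T = L³`,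
unbounded. (By particle–hole symmetry the functional for `N > L³/2` is a different, hole-removal field
of the conjugate state: the restriction is genuinely needed, not cosmetic.) [folklore] -/
theorem insertionFieldDelocalisation_false_without_halfFilling : ¬ WithoutHalfFilling := by
  rintro ⟨M, hM⟩
  obtain ⟨L, hL2, hLM⟩ := exists_side_gt M
  haveI : NeZero L := ⟨by omega⟩
  have hL3 : 2 ≤ L ^ 3 :=
    calc 2 ≤ 2 ^ 3 := by norm_num
      _ ≤ L ^ 3 := Nat.pow_le_pow_left hL2 3
  set σ₀ : TensorIndex (TorusSite 3 L) 2 :=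
    fun z => if z ∈ (Finset.univ : Finset (TorusSite 3 L)) then (0 : Fin 2) else 1 with hσ₀
  have hσ₀' : σ₀ = fun _ => 0 := by
    funext z
    simp [hσ₀]
  have hsec : bvec σ₀ ∈ spinZSector 1 (((L ^ 3 : ℕ) : ℝ) - (L : ℝ) ^ 3 / 2) := by
    refine bvec_ind_mem_spinZSector _ _ ?_
    rw [Finset.card_univ, card_torusSite 3 L]
    push_cast
    ring
  have hE : lowestEnergyInSector 1 (xyTorus 3 L 1) (((L ^ 3 : ℕ) : ℝ) - (L : ℝ) ^ 3 / 2) = 0 := by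
    refine lowestEnergyInSector_allUp _ _ _ ?_
    rw [card_torusSite 3 L]
    push_cast
    ring
  have heig : (xyTorus 3 L 1).mulVec (bvec σ₀) =
      ((lowestEnergyInSector 1 (xyTorus 3 L 1) (((L ^ 3 : ℕ) : ℝ) - (L : ℝ) ^ 3 / 2) : ℝ) : ℂ) •
        bvec σ₀ := by
    rw [hE, Complex.ofReal_zero, zero_smul, mulVec_bvec, hσ₀']
    funext σ
    exact xxz_apply_allUp _ _ σ
  have key := hM L hL2 (L ^ 3) hL3 (bvec σ₀) hsec (bvec_ne_zero _) heig (bvec_nonneg _)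
  rw [hσ₀, K1Ineq_fullState_iff M L hL2] at key
  linarith

end LoadBearing



end Summit.AtomisticToContinuum.BoseEinsteinCondensation.Theorems.InsertionFieldDelocalisation.Negative
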